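import Mathlib
import HarnessLib

/-!
# Zhang (2022), §16 p. 95, "`𝓡₂ⱼ = −1/(β₁L′(1,χ)) + O(𝓛⁶)`" — the numeric bookkeeping of the final bound

Topic `Literature/NumberTheory/LFunctions/Zhang2022` (Landau–Siegel audit tree; verdict-neutral).
Y. Zhang, *Discrete mean estimates and the Landau–Siegel zero*, arXiv:2211.02515v1 (2022)
[Zhang2022LandauSiegel] — **an unrefereed manuscript under adjudication**. Pure real arithmetic for the
"direct calculation" of §16 p. 95 (tex L4674–L4677, DAG `Z22:§16.u043`): `residue_bookkeeping` turns the
four-factor perturbation bound of `Section16ResidueValues` (`8(8Mα + 2E/(|β||L′|) + δ₃ + δ₄)·(|L′||γ|)⁻¹`)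
plus the main-term shift (`4ν/(α²|L′|)`) into `C·𝓛⁶`, using `α𝓛⁹ = π`, `|L′| ≥ (4e)⁻¹`, `|β|, |γ| ≥ α/2`,
`E = C₅₈𝓛⁻¹⁵`, `δ₃ ≤ K₃𝓛⁻⁶`, `δ₄ ≤ 𝓛⁻⁶`, `ν ≤ 12|c′|α²𝓛`. Consumed by `Section16RhoTwo`. Nothing of §16
is asserted here; nothing about Theorems 1–2 of the source.

## References

* Y. Zhang, arXiv:2211.02515v1 (2022), §16 p. 95. [cite: Zhang2022LandauSiegel, §16 p.95]
-/

noncomputable section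

open Real

namespace Literature.NumberTheory.LFunctions.Zhang2022.Skeleton

/-! ## The bookkeeping of the final bound (pure real arithmetic) -/

section Bookkeeping

/-- The common numeric bookkeeping of both residues: with `t = (|L||γ|)⁻¹ ≤ 8e𝓛⁹/π`
(`|L| ≥ (4e)⁻¹`, `|γ| ≥ α/2`, `α𝓛⁹ = π`), a perturbation sum `8Mα + 2E/(|β||L|) + δ₃ + δ₄` with
`E = C₅₈𝓛⁻¹⁵`, `|β| ≥ α/2`, `δ₃ ≤ K₃𝓛⁻⁶`, `δ₄ ≤ 𝓛⁻⁶`, and the main-term shift `4ν/(α²|L|)` with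
`ν ≤ 12cα²𝓛`: the total is `≤ (512eM + 1024e²C₅₈/π² + 64eK₃/π + 64e/π + 192ec)·𝓛⁶`.
[cite: Zhang2022LandauSiegel, §16 p.95] -/
theorem residue_bookkeeping {ℓ α M E nβ nL nγ δ₃ δ₄ ν c K₃ C₅₈ X : ℝ} (hℓ : 1 ≤ ℓ)
    (hα9 : α * ℓ ^ 9 = π) (hM : 0 ≤ M) (hnβ : α / 2 ≤ nβ) (hnL : 1 / (4 * Real.exp 1) ≤ nL)
    (hnγ : α / 2 ≤ nγ) (hE : E = C₅₈ / ℓ ^ 15) (hC58 : 0 ≤ C₅₈) (hδ₃ : δ₃ ≤ K₃ * (ℓ ^ 6)⁻¹)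
    (hK₃ : 0 ≤ K₃) (hδ₄ : δ₄ ≤ (ℓ ^ 6)⁻¹) (hν : ν ≤ 12 * c * α ^ 2 * ℓ) (hc : 0 ≤ c)
    (hX : X ≤ 8 * (8 * M * α + 2 * (E / (nβ * nL)) + δ₃ + δ₄) * (nL * nγ)⁻¹ + 4 * ν / (α ^ 2 * nL)) :
    X ≤ (512 * Real.exp 1 * M + 1024 * Real.exp 1 ^ 2 * C₅₈ / π ^ 2 + 64 * Real.exp 1 * K₃ / π +
      64 * Real.exp 1 / π + 192 * Real.exp 1 * c) * ℓ ^ 6 := by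
  have hℓ0 : 0 < ℓ := by linarith
  have hπ := Real.pi_pos
  have he := Real.exp_pos 1
  have hαeq : α = π / ℓ ^ 9 := by rw [← hα9]; field_simp
  have hα : 0 < α := by rw [hαeq]; positivity
  have hnL0 : 0 < nL := lt_of_lt_of_le (by positivity) hnL
  have hnβ0 : 0 < nβ := lt_of_lt_of_le (by positivity) hnβ
  have hnγ0 : 0 < nγ := lt_of_lt_of_le (by positivity) hnγ
  have hℓ6 : 1 ≤ ℓ ^ 6 := one_le_pow₀ hℓ
  have hℓ36 : ℓ ^ 3 ≤ ℓ ^ 6 := pow_le_pow_right₀ hℓ (by norm_num)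
  have hℓ16 : ℓ ≤ ℓ ^ 6 := le_self_pow₀ hℓ (by norm_num)
  set t : ℝ := (nL * nγ)⁻¹ with ht
  have ht0 : 0 ≤ t := by positivity
  -- `t ≤ 8eℓ⁹/π`, written as `α t ≤ 8e` and `t ≤ (8e/π) ℓ⁹`
  have hprod : α / (8 * Real.exp 1) ≤ nL * nγ := by
    calc α / (8 * Real.exp 1) = 1 / (4 * Real.exp 1) * (α / 2) := by ring
      _ ≤ nL * nγ := mul_le_mul hnL hnγ (by positivity) hnL0.le
  have hT : t ≤ 8 * Real.exp 1 / π * ℓ ^ 9 := by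
    calc t ≤ (α / (8 * Real.exp 1))⁻¹ := inv_anti₀ (by positivity) hprod
      _ = 8 * Real.exp 1 / π * ℓ ^ 9 := by rw [hαeq]; field_simp
  have hαT : α * t ≤ 8 * Real.exp 1 := by
    calc α * t ≤ α * (8 * Real.exp 1 / π * ℓ ^ 9) := by gcongr
      _ = 8 * Real.exp 1 / π * (α * ℓ ^ 9) := by ring
      _ = 8 * Real.exp 1 := by rw [hα9]; field_simp
  -- (a) `64 M α t ≤ 512 e M`
  have ha : 64 * M * α * t ≤ 512 * Real.exp 1 * M := by nlinarith
  -- (b) `16 (E/(nβ nL)) t ≤ 1024 e² C₅₈/π² · ℓ⁶`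
  have hb : 16 * (E / (nβ * nL)) * t ≤ 1024 * Real.exp 1 ^ 2 * C₅₈ / π ^ 2 * ℓ ^ 6 := by
    have hprod' : α / (8 * Real.exp 1) ≤ nβ * nL := by
      calc α / (8 * Real.exp 1) = (α / 2) * (1 / (4 * Real.exp 1)) := by ring
        _ ≤ nβ * nL := mul_le_mul hnβ hnL (by positivity) hnβ0.le
    have hE0 : 0 ≤ E := by rw [hE]; positivity
    have hE' : E / (nβ * nL) ≤ E / (α / (8 * Real.exp 1)) := by gcongr
    -- `E/(α/(8e)) · t = 8eE · t/α` and `E t ≤ C₅₈ ℓ⁻¹⁵ · (8e/π) ℓ⁹`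
    have hEt : E * t ≤ C₅₈ / ℓ ^ 15 * (8 * Real.exp 1 / π * ℓ ^ 9) := by
      rw [hE]; exact mul_le_mul_of_nonneg_left hT (by positivity)
    have h915 : C₅₈ / ℓ ^ 15 * (8 * Real.exp 1 / π * ℓ ^ 9) = 8 * Real.exp 1 * C₅₈ / π * (ℓ ^ 6)⁻¹ := by
      field_simp
    rw [h915] at hEt
    calc 16 * (E / (nβ * nL)) * t ≤ 16 * (E / (α / (8 * Real.exp 1))) * t := by gcongr
      _ = 128 * Real.exp 1 * (ℓ ^ 9 / π) * (E * t) := by rw [hαeq]; field_simp; ring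
      _ ≤ 128 * Real.exp 1 * (ℓ ^ 9 / π) * (8 * Real.exp 1 * C₅₈ / π * (ℓ ^ 6)⁻¹) := by gcongr
      _ = 1024 * Real.exp 1 ^ 2 * C₅₈ / π ^ 2 * ℓ ^ 3 := by field_simp; ring
      _ ≤ 1024 * Real.exp 1 ^ 2 * C₅₈ / π ^ 2 * ℓ ^ 6 := by gcongr
  -- (c) `8 δ₃ t ≤ 64 e K₃/π · ℓ⁶`
  have hc' : 8 * δ₃ * t ≤ 64 * Real.exp 1 * K₃ / π * ℓ ^ 6 := by
    have : δ₃ * t ≤ K₃ * (ℓ ^ 6)⁻¹ * (8 * Real.exp 1 / π * ℓ ^ 9) := mul_le_mul hδ₃ hT ht0 (by positivity)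
    have h2 : K₃ * (ℓ ^ 6)⁻¹ * (8 * Real.exp 1 / π * ℓ ^ 9) = 8 * Real.exp 1 * K₃ / π * ℓ ^ 3 := by
      field_simp
    rw [h2] at this
    calc 8 * δ₃ * t = 8 * (δ₃ * t) := by ring
      _ ≤ 8 * (8 * Real.exp 1 * K₃ / π * ℓ ^ 3) := by gcongr
      _ ≤ 8 * (8 * Real.exp 1 * K₃ / π * ℓ ^ 6) := by gcongr
      _ = 64 * Real.exp 1 * K₃ / π * ℓ ^ 6 := by ring
  -- (d) `8 δ₄ t ≤ 64 e/π · ℓ⁶`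
  have hd : 8 * δ₄ * t ≤ 64 * Real.exp 1 / π * ℓ ^ 6 := by
    have : δ₄ * t ≤ (ℓ ^ 6)⁻¹ * (8 * Real.exp 1 / π * ℓ ^ 9) := mul_le_mul hδ₄ hT ht0 (by positivity)
    have h2 : (ℓ ^ 6)⁻¹ * (8 * Real.exp 1 / π * ℓ ^ 9) = 8 * Real.exp 1 / π * ℓ ^ 3 := by
      field_simp
    rw [h2] at this
    calc 8 * δ₄ * t = 8 * (δ₄ * t) := by ring
      _ ≤ 8 * (8 * Real.exp 1 / π * ℓ ^ 3) := by gcongr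
      _ ≤ 8 * (8 * Real.exp 1 / π * ℓ ^ 6) := by gcongr
      _ = 64 * Real.exp 1 / π * ℓ ^ 6 := by ring
  -- (e) `4ν/(α² nL) ≤ 192 e c ℓ ≤ 192 e c ℓ⁶`
  have he' : 4 * ν / (α ^ 2 * nL) ≤ 192 * Real.exp 1 * c * ℓ ^ 6 := by
    rw [div_le_iff₀ (by positivity)]
    have h1 : 4 * ν ≤ 48 * c * α ^ 2 * ℓ := by linarith
    have h2 : 48 * c * α ^ 2 * ℓ ≤ 192 * Real.exp 1 * c * ℓ ^ 6 * (α ^ 2 * nL) := by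
      have : 48 * c * α ^ 2 * ℓ = 192 * Real.exp 1 * c * ℓ * (α ^ 2 * (1 / (4 * Real.exp 1))) := by
        field_simp; ring
      rw [this]
      have hcℓ : 192 * Real.exp 1 * c * ℓ ≤ 192 * Real.exp 1 * c * ℓ ^ 6 := by gcongr
      exact mul_le_mul hcℓ (by gcongr) (by positivity) (by positivity)
    linarith
  -- total
  have hsplit : 8 * (8 * M * α + 2 * (E / (nβ * nL)) + δ₃ + δ₄) * t + 4 * ν / (α ^ 2 * nL) =
      64 * M * α * t + 16 * (E / (nβ * nL)) * t + 8 * δ₃ * t + 8 * δ₄ * t + 4 * ν / (α ^ 2 * nL) := by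
    ring
  rw [hsplit] at hX
  have hM6 : 512 * Real.exp 1 * M ≤ 512 * Real.exp 1 * M * ℓ ^ 6 := by
    have : 0 ≤ 512 * Real.exp 1 * M := by positivity
    nlinarith
  calc X ≤ _ := hX
    _ ≤ 512 * Real.exp 1 * M * ℓ ^ 6 + 1024 * Real.exp 1 ^ 2 * C₅₈ / π ^ 2 * ℓ ^ 6 +
        64 * Real.exp 1 * K₃ / π * ℓ ^ 6 + 64 * Real.exp 1 / π * ℓ ^ 6 +
        192 * Real.exp 1 * c * ℓ ^ 6 := by linarith
    _ = _ := by ring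

end Bookkeeping

end Literature.NumberTheory.LFunctions.Zhang2022.Skeleton
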